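/-
Origin: expansion seat `planner-pub-hodgecm-mc-theta-3-g13-0`, handover (K11) 2026-08-20T10:07:15Z md5 7963541838e60f69c60b8c21416231ca (342 l., 30 decls; NEW additive drop-alone leaf over RUN-47 (K9) `ArchConjFrameTransport`; transport dictionary J_S ↔ 1 ⊗ Λ slice-wise + resEnd Levi form for #1221 hP/hQ; cert rc 0/0 warn/0 proof holes; axioms 30/30 ⊆ trio) (`HOME/mc/pub-hodgecm-mc-theta-3-g13/lean/stage48/HodgeCM/Model/ArchConjFrameTransportMatrix.lean`, md5 7963541838e6, 342 lines);
landed by the second packager p2 gen 6 (p2-g6) in gate run 48 as `HodgeCM/Model/ArchConjFrameTransportMatrix.lean` (verbatim).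
-/
/-
Origin: speedrun cell pub-hodgecm, MODEL-CONSTRUCTION sub-cell, lineage mc-theta-3 (theta supply / second-lift lane, BINDER-OWNERS row 5 `S` slot),
seat planner-pub-hodgecm-mc-theta-3-g13-0 (gen 13), 2026-08-20.  Target in PKG: `HodgeCM/Model/ArchConjFrameTransportMatrix.lean`
(NEW additive drop-alone leaf; imports (K9) `Model/ArchConjFrameTransport` (RUN 47), hence (K7) `Model/ArchConjTorusTransport` (RUN 46)).
KERNEL only: 0 records, 0 `def … : Prop`, 0 cites, 0 proof holes; intended closure {propext, Classical.choice, Quot.sound}.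
-/
import Summits.HodgeConjecture.HodgeCM.Model.ArchConjFrameTransport_2

/-!
# (J-μ) slots 2/3: the transport DICTIONARY — (K9)'s frame map `J_S` is (K7)'s matrix `1 ⊗ Λ`, slice by slice

(K7) `Model/ArchConjTorusTransport` built, at every infinite place `w` of `L`, the permutation-and-rescaling matrix
`Λ_w = transportMatAt S w` and its inverse `transportInvAt S w` (`M_wᴴ · diag(w ∘ dW') · M_w = diag(w ∘ dW)`), and (K9)
`Model/ArchConjFrameTransport` built the Folland-frame transport `J_S = conjFrameTransport V S` with `Φ_{X'} ∘ J_S = Φ_X`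
together with its coordinates `conjFrameTransport_apply_fst`.  This leaf is the dictionary between the two:

* §0 a general fact on quadratic coordinates: a matrix with entries in `φ(R)` acts block-DIAGONALLY,
  `resEnd (G.map φ) (a, b) = (G a, G b)` (`quadResEnd_map_apply_mk`) — the Levi shape of a real matrix;
* §1 the entries of `Λ_w`, `Λ_w⁻¹` (`transportMatAt_apply`, `transportInvAt_apply`: one non-zero entry per row, in column
  `σ_w j`), the REAL matrices `transportReAt`, `transportReInvAt` with `(transportReAt S w).map (↑) = transportMatAt S w`, and the
  involutivity of the bit permutation `bitPerm_bitPerm`;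
* §2 the frame-scaling ratio is (K7)'s rescaling: `D^X_W(v, σ_v j) / D^{X'}_W(v, j) = λ_{σ_v j}(placeUp v)`
  (`cmDW_bitPerm_div_cmDW'`), through `(placeUp v).embedding ∘ algebraMap = embedding_of_isReal v`;
* §3 the real `6 × 6` matrices `frameTransportMat S v = 1₃ ⊗ Re Λ_{placeUp v}`, `frameTransportInv S v = 1₃ ⊗ Re Λ⁻¹_{placeUp v}` on the slot
  index `Fin (3·2)` (through `finProdFinEquiv`), mutually inverse, with complexifications `1 ⊗ₖ transportMatAt`, `1 ⊗ₖ transportInvAt`,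
  and the HEADLINES **`placeVec_conjFrameTransport`**: `placeVec v (J_S y) = frameTransportMat S v *ᵥ placeVec v y` and
  **`placeVec_conjFrameTransport_symm`**: `placeVec v (J_S⁻¹ y) = frameTransportInv S v *ᵥ placeVec v y`;
* §4 the `resEnd` form matching the right-hand side of `ArchActQuadraticPlaces.placeVec_archAct_toSp`: for every purely imaginary `δ'`,
  **`resEnd (reindex e e (1 ⊗ₖ transportInvAt S (placeUp v))) (placeVec v a, placeVec v b) = (placeVec v (J_S⁻¹ a), placeVec v (J_S⁻¹ b))`**
  (`quadResEnd_oneKronecker_transportInvAt`; twin `quadResEnd_oneKronecker_transportMatAt` for `Λ` and `J_S`), and the extensionality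
  `eq_of_placeVec_eq` (`L⁺` has no complex place).

So an archimedean element acting at the complex place over `v` through the REAL matrix `1 ⊗ Λ_w⁻¹` acts on `(L⁺ ⊗ ℝ)^{3·2} × (L⁺ ⊗ ℝ)^{3·2}` as the
Levi element `(J_S⁻¹, J_S⁻¹)`.  Nothing here is a claim of PerL/QW8; nothing is cited as a fact.
-/

set_option autoImplicit false

noncomputable section

open scoped Matrix Classical Kronecker
open NumberField (InfinitePlace maximalRealSubfield IsCMField)
open NumberField.InfinitePlace (embedding_of_isReal)
open NumberField.mixedEmbedding (mixedSpace)
open Literature.NumberTheory.Automorphic Literature.NumberTheory.Automorphic.UnitaryGroup Literature.NumberTheory.Weil1964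
open Literature.NumberTheory.Automorphic.UnitaryGroup.QuadraticCoordinates
open Literature.NumberTheory.GelbartRogawski1991 Literature.NumberTheory.GelbartRogawski1991.UnitaryDualPair
open HodgeCM.Adelic HodgeCM.PerL34 HodgeCM.Model.HypCensus

namespace HodgeCM.Model.ArchSideTerm

/-! ## §0 a matrix with scalar entries acts block-diagonally in quadratic coordinates -/

section Quad

variable {R T : Type*} [CommRing R] [CommRing T] {φ : R →+* T} {Ψ : (R × R) ≃+ T} {δ : T} {d : R}

/-- **Levi shape of a scalar matrix**: in the coordinates `reIm`, the matrix `G.map φ` (entries in `φ(R)`) acts on `Rⁿ × Rⁿ` as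
`(a, b) ↦ (G a, G b)`. -/
theorem quadResEnd_map_apply_mk (h : IsQuadraticCoordinates φ Ψ δ d) (n : Type*) [Fintype n] [DecidableEq n]
    (G : Matrix n n R) (a b : n → R) : h.resEnd n (G.map φ) (a, b) = (G *ᵥ a, G *ᵥ b) := by
  have hab : (a, b) = reIm Ψ n ((reIm Ψ n).symm (a, b)) := ((reIm Ψ n).apply_symm_apply (a, b)).symm
  rw [hab, h.resEnd_reIm]
  refine Prod.ext (funext fun i => ?_) (funext fun i => ?_)
  · simp only [reIm_apply_fst, reIm_symm_apply, Matrix.mulVec, dotProduct, map_sum, h.re_mul, re_apply, im_apply, Matrix.map_apply,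
      h.re_map, h.im_map, zero_mul, mul_zero, add_zero]
  · simp only [reIm_apply_snd, reIm_symm_apply, Matrix.mulVec, dotProduct, map_sum, h.im_mul, re_apply, im_apply, Matrix.map_apply,
      h.re_map, h.im_map, zero_mul, add_zero]

end Quad

/-! ## §1 the entries of (K7)'s place-wise transport matrices -/

section Entries

variable {L : CMField} (S : StubTree.SeesawDatum L) (w : InfinitePlace (L : Type))

/-- the bit permutation is an involution. -/
@[simp] theorem bitPerm_bitPerm (j : Fin 2) : bitPerm S w (bitPerm S w j) = j := by
  by_cases h : conjSwapAt S w
  · revert j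
    rw [Fin.forall_fin_two, bitPerm_zero_of S w h, bitPerm_one_of S w h, bitPerm_zero_of S w h]
    exact ⟨rfl, rfl⟩
  · rw [bitPerm_of_not S w h, bitPerm_of_not S w h]

/-- entries of `Λ_w`: row `j` has the single entry `λ_{σ_w j}(w)` in column `σ_w j`. -/
theorem transportMatAt_apply (j j' : Fin 2) :
    transportMatAt S w j j' = if j' = bitPerm S w j then ((transportScale S w (bitPerm S w j) : ℝ) : ℂ) else 0 := by
  unfold transportMatAt
  by_cases h : conjSwapAt S w
  · rw [if_pos h]
    fin_cases j <;> fin_cases j' <;> simp [bitPerm_zero_of S w h, bitPerm_one_of S w h]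
  · rw [if_neg h]
    fin_cases j <;> fin_cases j' <;> simp [bitPerm_of_not S w h]

/-- entries of `Λ_w⁻¹`: row `j` has the single entry `λ_j(w)⁻¹` in column `σ_w j`. -/
theorem transportInvAt_apply (j j' : Fin 2) :
    transportInvAt S w j j' = if j' = bitPerm S w j then (((transportScale S w j : ℝ) : ℂ))⁻¹ else 0 := by
  unfold transportInvAt
  by_cases h : conjSwapAt S w
  · rw [if_pos h]
    fin_cases j <;> fin_cases j' <;> simp [bitPerm_zero_of S w h, bitPerm_one_of S w h]
  · rw [if_neg h]
    fin_cases j <;> fin_cases j' <;> simp [bitPerm_of_not S w h]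

/-- the REAL transport matrix `Re Λ_w`. -/
def transportReAt : Matrix (Fin 2) (Fin 2) ℝ :=
  if conjSwapAt S w then !![0, transportScale S w 1; transportScale S w 0, 0]
  else !![transportScale S w 0, 0; 0, transportScale S w 1]

/-- the REAL inverse transport matrix `Re Λ_w⁻¹`. -/
def transportReInvAt : Matrix (Fin 2) (Fin 2) ℝ :=
  if conjSwapAt S w then !![0, (transportScale S w 0)⁻¹; (transportScale S w 1)⁻¹, 0]
  else !![(transportScale S w 0)⁻¹, 0; 0, (transportScale S w 1)⁻¹]

/-- `Λ_w` is real: `(Re Λ_w) ↦ ℂ = Λ_w`. -/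
theorem transportReAt_map : (transportReAt S w).map ⇑Complex.ofRealHom = transportMatAt S w := by
  unfold transportReAt transportMatAt
  split_ifs <;>
  · ext i j
    fin_cases i <;> fin_cases j <;> simp [Complex.ofRealHom_eq_coe]

/-- `Λ_w⁻¹` is real. -/
theorem transportReInvAt_map : (transportReInvAt S w).map ⇑Complex.ofRealHom = transportInvAt S w := by
  unfold transportReInvAt transportInvAt
  split_ifs <;>
  · ext i j
    fin_cases i <;> fin_cases j <;> simp [Complex.ofRealHom_eq_coe]

/-- (Ported verbatim from the HodgeCMPerL package; no docstring in the source.) -/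
theorem transportReAt_apply (j j' : Fin 2) :
    transportReAt S w j j' = if j' = bitPerm S w j then transportScale S w (bitPerm S w j) else 0 := by
  unfold transportReAt
  by_cases h : conjSwapAt S w
  · rw [if_pos h]
    fin_cases j <;> fin_cases j' <;> simp [bitPerm_zero_of S w h, bitPerm_one_of S w h]
  · rw [if_neg h]
    fin_cases j <;> fin_cases j' <;> simp [bitPerm_of_not S w h]

/-- (Ported verbatim from the HodgeCMPerL package; no docstring in the source.) -/
theorem transportReInvAt_apply (j j' : Fin 2) :
    transportReInvAt S w j j' = if j' = bitPerm S w j then (transportScale S w j)⁻¹ else 0 := by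
  unfold transportReInvAt
  by_cases h : conjSwapAt S w
  · rw [if_pos h]
    fin_cases j <;> fin_cases j' <;> simp [bitPerm_zero_of S w h, bitPerm_one_of S w h]
  · rw [if_neg h]
    fin_cases j <;> fin_cases j' <;> simp [bitPerm_of_not S w h]

/-- (Ported verbatim from the HodgeCMPerL package; no docstring in the source.) -/
theorem transportReAt_mul_inv : transportReAt S w * transportReInvAt S w = 1 := by
  have h0 := (transportScale_pos S w 0).ne'
  have h1 := (transportScale_pos S w 1).ne'
  unfold transportReAt transportReInvAt
  split_ifs <;>
  · ext i j
    fin_cases i <;> fin_cases j <;> simp [Matrix.mul_apply, Fin.sum_univ_two, h0, h1]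

/-- (Ported verbatim from the HodgeCMPerL package; no docstring in the source.) -/
theorem transportReInvAt_mul : transportReInvAt S w * transportReAt S w = 1 := by
  have h0 := (transportScale_pos S w 0).ne'
  have h1 := (transportScale_pos S w 1).ne'
  unfold transportReAt transportReInvAt
  split_ifs <;>
  · ext i j
    fin_cases i <;> fin_cases j <;> simp [Matrix.mul_apply, Fin.sum_univ_two, h0, h1]

end Entries

/-! ## §2 the frame-scaling ratio is (K7)'s rescaling -/

section Ratio

variable {L : CMField} {ι₁ : L →+* ℂ} (V : HermSpace3 L ι₁) (S : StubTree.SeesawDatum L)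

/-- the embedding of the place `placeUp v` of `L` restricts on `L⁺` to the real embedding of `v`. -/
theorem embedding_placeUp_algebraMap (v : {v : InfinitePlace (↥(maximalRealSubfield (L : Type))) // v.IsReal})
    (x : ↥(maximalRealSubfield (L : Type))) :
    (placeUp (L := L) v).embedding (algebraMap (↥(maximalRealSubfield (L : Type))) (L : Type) x) = ((embedding_of_isReal v.2 x : ℝ) : ℂ) :=
  embedding_algebraMap_eq_embedding_of_isReal (L : Type) v (placeUp (L := L) v).embedding
    (by rw [InfinitePlace.mk_embedding]; exact cmPlaceOver_comap (L : Type) v) x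

/-- `Re (placeUp v)(dW_j) = v(dW_j)` (the letters are in `L⁺`). -/
theorem re_embedding_placeUp_dW (v : {v : InfinitePlace (↥(maximalRealSubfield (L : Type))) // v.IsReal}) (j : Fin 2) :
    ((placeUp (L := L) v).embedding (dW S j)).re = embedding_of_isReal v.2 (cmRealVec (L : Type) (dW S) (dW_real S) j) := by
  have h := embedding_placeUp_algebraMap (L := L) v (cmRealVec (L : Type) (dW S) (dW_real S) j)
  rw [show algebraMap (↥(maximalRealSubfield (L : Type))) (L : Type) (cmRealVec (L : Type) (dW S) (dW_real S) j) = dW S j from rfl] at h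
  rw [h, Complex.ofReal_re]

/-- (Ported verbatim from the HodgeCMPerL package; no docstring in the source.) -/
theorem re_embedding_placeUp_dW' (v : {v : InfinitePlace (↥(maximalRealSubfield (L : Type))) // v.IsReal}) (j : Fin 2) :
    ((placeUp (L := L) v).embedding (dW' S j)).re = embedding_of_isReal v.2 (cmRealVec (L : Type) (dW' S) (dW'_real S) j) := by
  have h := embedding_placeUp_algebraMap (L := L) v (cmRealVec (L : Type) (dW' S) (dW'_real S) j)
  rw [show algebraMap (↥(maximalRealSubfield (L : Type))) (L : Type) (cmRealVec (L : Type) (dW' S) (dW'_real S) j) = dW' S j from rfl] at h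
  rw [h, Complex.ofReal_re]

/-- **the frame-scaling ratio is the rescaling**: `D^X_W(v, σ_v j) / D^{X'}_W(v, j) = λ_{σ_v j}(placeUp v)`. -/
theorem cmDW_bitPerm_div_cmDW' (v : {v : InfinitePlace (↥(maximalRealSubfield (L : Type))) // v.IsReal}) (j : Fin 2) :
    cmDW (L : Type) (frameD V) (dW S) (dW_real S) ι₁ v (bitPerm S (placeUp v) j) / cmDW (L : Type) (frameD V) (dW' S) (dW'_real S) ι₁ v j =
      transportScale S (placeUp v) (bitPerm S (placeUp v) j) := by
  have hc : cmCW (L : Type) (frameD V) ι₁ v ≠ 0 := cmCW_ne_zero (L : Type) (frameD V) ι₁ v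
  have hpos := transportScale_ratio_pos S (placeUp v) (bitPerm S (placeUp v) j)
  rw [bitPerm_bitPerm] at hpos
  rw [transportScale, bitPerm_bitPerm]
  change Real.sqrt |embedding_of_isReal v.2 (cmRealVec (L : Type) (dW S) (dW_real S) (bitPerm S (placeUp v) j)) / cmCW (L : Type) (frameD V) ι₁ v| /
      Real.sqrt |embedding_of_isReal v.2 (cmRealVec (L : Type) (dW' S) (dW'_real S) j) / cmCW (L : Type) (frameD V) ι₁ v| = _
  rw [← re_embedding_placeUp_dW S v, ← re_embedding_placeUp_dW' S v, ← Real.sqrt_div (abs_nonneg _),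
    abs_div (((placeUp (L := L) v).embedding (dW S (bitPerm S (placeUp v) j))).re) (cmCW (L : Type) (frameD V) ι₁ v),
    abs_div (((placeUp (L := L) v).embedding (dW' S j)).re) (cmCW (L : Type) (frameD V) ι₁ v),
    div_div_div_cancel_right₀ (abs_ne_zero.2 hc), ← abs_div, abs_of_pos hpos]

end Ratio

/-! ## §3 the real frame matrices and the coordinates of `J_S`, `J_S⁻¹` -/

section Frame

variable {L : CMField} {ι₁ : L →+* ℂ} (V : HermSpace3 L ι₁) (S : StubTree.SeesawDatum L)

/-- `1₃ ⊗ Re Λ_{placeUp v}` on the slot index `Fin (3·2)`. -/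
def frameTransportMat (v : {v : InfinitePlace (↥(maximalRealSubfield (L : Type))) // v.IsReal}) : Matrix (Fin (3 * 2)) (Fin (3 * 2)) ℝ :=
  Matrix.reindex finProdFinEquiv finProdFinEquiv ((1 : Matrix (Fin 3) (Fin 3) ℝ) ⊗ₖ transportReAt S (placeUp v))

/-- `1₃ ⊗ Re Λ⁻¹_{placeUp v}` on the slot index `Fin (3·2)`. -/
def frameTransportInv (v : {v : InfinitePlace (↥(maximalRealSubfield (L : Type))) // v.IsReal}) : Matrix (Fin (3 * 2)) (Fin (3 * 2)) ℝ :=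
  Matrix.reindex finProdFinEquiv finProdFinEquiv ((1 : Matrix (Fin 3) (Fin 3) ℝ) ⊗ₖ transportReInvAt S (placeUp v))

/-- (Ported verbatim from the HodgeCMPerL package; no docstring in the source.) -/
theorem frameTransportMat_apply (v : {v : InfinitePlace (↥(maximalRealSubfield (L : Type))) // v.IsReal}) (i i' : Fin 3) (j j' : Fin 2) :
    frameTransportMat S v (finProdFinEquiv (i, j)) (finProdFinEquiv (i', j')) = if i = i' then transportReAt S (placeUp v) j j' else 0 := by
  simp only [frameTransportMat, Matrix.reindex_apply, Matrix.submatrix_apply, Equiv.symm_apply_apply, Matrix.kroneckerMap_apply, Matrix.one_apply,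
    ite_mul, one_mul, zero_mul]

/-- (Ported verbatim from the HodgeCMPerL package; no docstring in the source.) -/
theorem frameTransportInv_apply (v : {v : InfinitePlace (↥(maximalRealSubfield (L : Type))) // v.IsReal}) (i i' : Fin 3) (j j' : Fin 2) :
    frameTransportInv S v (finProdFinEquiv (i, j)) (finProdFinEquiv (i', j')) = if i = i' then transportReInvAt S (placeUp v) j j' else 0 := by
  simp only [frameTransportInv, Matrix.reindex_apply, Matrix.submatrix_apply, Equiv.symm_apply_apply, Matrix.kroneckerMap_apply, Matrix.one_apply,
    ite_mul, one_mul, zero_mul]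

/-- (Ported verbatim from the HodgeCMPerL package; no docstring in the source.) -/
theorem frameTransportMat_mul_inv (v : {v : InfinitePlace (↥(maximalRealSubfield (L : Type))) // v.IsReal}) :
    frameTransportMat S v * frameTransportInv S v = 1 := by
  rw [frameTransportMat, frameTransportInv, Matrix.reindex_apply, Matrix.reindex_apply, Matrix.submatrix_mul_equiv, ← Matrix.mul_kronecker_mul,
    Matrix.mul_one, transportReAt_mul_inv, Matrix.one_kronecker_one, Matrix.submatrix_one_equiv]

/-- (Ported verbatim from the HodgeCMPerL package; no docstring in the source.) -/
theorem frameTransportInv_mul (v : {v : InfinitePlace (↥(maximalRealSubfield (L : Type))) // v.IsReal}) :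
    frameTransportInv S v * frameTransportMat S v = 1 := by
  rw [frameTransportMat, frameTransportInv, Matrix.reindex_apply, Matrix.reindex_apply, Matrix.submatrix_mul_equiv, ← Matrix.mul_kronecker_mul,
    Matrix.mul_one, transportReInvAt_mul, Matrix.one_kronecker_one, Matrix.submatrix_one_equiv]

/-- complexification: `(1₃ ⊗ Re Λ) ↦ ℂ = 1₃ ⊗ₖ Λ` (reindexed). -/
theorem frameTransportMat_map (v : {v : InfinitePlace (↥(maximalRealSubfield (L : Type))) // v.IsReal}) :
    (frameTransportMat S v).map ⇑Complex.ofRealHom =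
      Matrix.reindex finProdFinEquiv finProdFinEquiv ((1 : Matrix (Fin 3) (Fin 3) ℂ) ⊗ₖ transportMatAt S (placeUp v)) := by
  rw [← transportReAt_map]
  ext k k'
  obtain ⟨⟨i, j⟩, rfl⟩ := finProdFinEquiv.surjective k
  obtain ⟨⟨i', j'⟩, rfl⟩ := finProdFinEquiv.surjective k'
  simp only [Matrix.map_apply, frameTransportMat_apply, Matrix.reindex_apply, Matrix.submatrix_apply, Equiv.symm_apply_apply, Matrix.kroneckerMap_apply,
    Matrix.one_apply, ite_mul, one_mul, zero_mul, apply_ite ⇑Complex.ofRealHom, map_zero]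

/-- (Ported verbatim from the HodgeCMPerL package; no docstring in the source.) -/
theorem frameTransportInv_map (v : {v : InfinitePlace (↥(maximalRealSubfield (L : Type))) // v.IsReal}) :
    (frameTransportInv S v).map ⇑Complex.ofRealHom =
      Matrix.reindex finProdFinEquiv finProdFinEquiv ((1 : Matrix (Fin 3) (Fin 3) ℂ) ⊗ₖ transportInvAt S (placeUp v)) := by
  rw [← transportReInvAt_map]
  ext k k'
  obtain ⟨⟨i, j⟩, rfl⟩ := finProdFinEquiv.surjective k
  obtain ⟨⟨i', j'⟩, rfl⟩ := finProdFinEquiv.surjective k'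
  simp only [Matrix.map_apply, frameTransportInv_apply, Matrix.reindex_apply, Matrix.submatrix_apply, Equiv.symm_apply_apply, Matrix.kroneckerMap_apply,
    Matrix.one_apply, ite_mul, one_mul, zero_mul, apply_ite ⇑Complex.ofRealHom, map_zero]

/-- `(1₃ ⊗ Re Λ) · p` entrywise: `λ_{σ j} · p_{(i, σ j)}`. -/
theorem frameTransportMat_mulVec (v : {v : InfinitePlace (↥(maximalRealSubfield (L : Type))) // v.IsReal}) (p : Fin (3 * 2) → ℝ)
    (i : Fin 3) (j : Fin 2) :
    (frameTransportMat S v *ᵥ p) (finProdFinEquiv (i, j)) =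
      transportScale S (placeUp v) (bitPerm S (placeUp v) j) * p (finProdFinEquiv (i, bitPerm S (placeUp v) j)) := by
  change (∑ k', frameTransportMat S v (finProdFinEquiv (i, j)) k' * p k') = _
  refine (Finset.sum_eq_single_of_mem (finProdFinEquiv (i, bitPerm S (placeUp v) j)) (Finset.mem_univ _) fun k' _ hk' => ?_).trans ?_
  · obtain ⟨⟨i', j'⟩, rfl⟩ := finProdFinEquiv.surjective k'
    rw [frameTransportMat_apply, transportReAt_apply]
    by_cases hi : i = i'
    · subst hi
      have hj : ¬ j' = bitPerm S (placeUp v) j := fun h => hk' (by rw [h])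
      rw [if_pos rfl, if_neg hj, zero_mul]
    · rw [if_neg hi, zero_mul]
  · rw [frameTransportMat_apply, if_pos rfl, transportReAt_apply, if_pos rfl]

/-- **the coordinates of `J_S` are `1 ⊗ Λ`**: `placeVec v (J_S y) = (1₃ ⊗ Re Λ_{placeUp v}) · placeVec v y`. -/
theorem placeVec_conjFrameTransport (y : Fin (3 * 2) → mixedSpace (↥(maximalRealSubfield (L : Type))))
    (v : {v : InfinitePlace (↥(maximalRealSubfield (L : Type))) // v.IsReal}) :
    placeVec (↥(maximalRealSubfield (L : Type))) (Fin (3 * 2)) v (conjFrameTransport V S y) =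
      frameTransportMat S v *ᵥ placeVec (↥(maximalRealSubfield (L : Type))) (Fin (3 * 2)) v y := by
  funext k
  obtain ⟨⟨i, j⟩, rfl⟩ := finProdFinEquiv.surjective k
  have hD : cmDV (L : Type) (frameD V) (frameD_real V) ι₁ v i ≠ 0 := cmDV_ne_zero (L : Type) (frameD V) (frameD_real V) (frameD_ne V) ι₁ v i
  rw [placeVec_apply, conjFrameTransport_apply_fst, mul_assoc, mul_div_mul_left _ _ hD, mul_div_right_comm, cmDW_bitPerm_div_cmDW' V S v j,
    frameTransportMat_mulVec, placeVec_apply]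

/-- **the coordinates of `J_S⁻¹` are `1 ⊗ Λ⁻¹`**: `placeVec v (J_S⁻¹ y) = (1₃ ⊗ Re Λ⁻¹_{placeUp v}) · placeVec v y`. -/
theorem placeVec_conjFrameTransport_symm (y : Fin (3 * 2) → mixedSpace (↥(maximalRealSubfield (L : Type))))
    (v : {v : InfinitePlace (↥(maximalRealSubfield (L : Type))) // v.IsReal}) :
    placeVec (↥(maximalRealSubfield (L : Type))) (Fin (3 * 2)) v ((conjFrameTransport V S).symm y) =
      frameTransportInv S v *ᵥ placeVec (↥(maximalRealSubfield (L : Type))) (Fin (3 * 2)) v y := by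
  have h := placeVec_conjFrameTransport V S ((conjFrameTransport V S).symm y) v
  rw [ContinuousLinearEquiv.apply_symm_apply] at h
  rw [h, Matrix.mulVec_mulVec, frameTransportInv_mul, Matrix.one_mulVec]

/-- extensionality through the real places (`L⁺` is totally real). -/
theorem eq_of_placeVec_eq {n : ℕ} (a b : Fin n → mixedSpace (↥(maximalRealSubfield (L : Type))))
    (h : ∀ v, placeVec (↥(maximalRealSubfield (L : Type))) (Fin n) v a = placeVec (↥(maximalRealSubfield (L : Type))) (Fin n) v b) : a = b := by
  haveI := isEmpty_isComplex (F := ↥(maximalRealSubfield (L : Type)))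
  funext k
  refine Prod.ext (funext fun v => ?_) (funext fun w => isEmptyElim w)
  exact congrFun (h v) k

end Frame

/-! ## §4 the `resEnd` (Levi) form -/

section Levi

variable {L : CMField} {ι₁ : L →+* ℂ} (V : HermSpace3 L ι₁) (S : StubTree.SeesawDatum L)

/-- **the Levi shape of `1 ⊗ Λ⁻¹`**: in the quadratic coordinates of ANY purely imaginary `δ'`, the real matrix
`reindex e e (1₃ ⊗ₖ Λ⁻¹_{placeUp v})` acts on `ℝ^{3·2} × ℝ^{3·2}` (the `v`-slices) as `(J_S⁻¹, J_S⁻¹)` — the shape `hP`/`hQ` of sinst-1's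
`exists_archFactor_eq_smul_archRepMp_compCLE` with `P = Q = (conjFrameTransport V S).symm`. -/
theorem quadResEnd_oneKronecker_transportInvAt (δ' : ℂ) (hre : δ'.re = 0) (him : δ'.im ≠ 0)
    (v : {v : InfinitePlace (↥(maximalRealSubfield (L : Type))) // v.IsReal}) (a b : Fin (3 * 2) → mixedSpace (↥(maximalRealSubfield (L : Type)))) :
    (isQuadraticCoordinates_complex δ' hre him).resEnd (Fin (3 * 2))
        (Matrix.reindex finProdFinEquiv finProdFinEquiv ((1 : Matrix (Fin 3) (Fin 3) ℂ) ⊗ₖ transportInvAt S (placeUp v)))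
        (placeVec (↥(maximalRealSubfield (L : Type))) (Fin (3 * 2)) v a, placeVec (↥(maximalRealSubfield (L : Type))) (Fin (3 * 2)) v b) =
      (placeVec (↥(maximalRealSubfield (L : Type))) (Fin (3 * 2)) v ((conjFrameTransport V S).symm a),
        placeVec (↥(maximalRealSubfield (L : Type))) (Fin (3 * 2)) v ((conjFrameTransport V S).symm b)) := by
  rw [← frameTransportInv_map, quadResEnd_map_apply_mk, placeVec_conjFrameTransport_symm, placeVec_conjFrameTransport_symm]

/-- the twin for `Λ` and `J_S`. -/
theorem quadResEnd_oneKronecker_transportMatAt (δ' : ℂ) (hre : δ'.re = 0) (him : δ'.im ≠ 0)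
    (v : {v : InfinitePlace (↥(maximalRealSubfield (L : Type))) // v.IsReal}) (a b : Fin (3 * 2) → mixedSpace (↥(maximalRealSubfield (L : Type)))) :
    (isQuadraticCoordinates_complex δ' hre him).resEnd (Fin (3 * 2))
        (Matrix.reindex finProdFinEquiv finProdFinEquiv ((1 : Matrix (Fin 3) (Fin 3) ℂ) ⊗ₖ transportMatAt S (placeUp v)))
        (placeVec (↥(maximalRealSubfield (L : Type))) (Fin (3 * 2)) v a, placeVec (↥(maximalRealSubfield (L : Type))) (Fin (3 * 2)) v b) =
      (placeVec (↥(maximalRealSubfield (L : Type))) (Fin (3 * 2)) v (conjFrameTransport V S a),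
        placeVec (↥(maximalRealSubfield (L : Type))) (Fin (3 * 2)) v (conjFrameTransport V S b)) := by
  rw [← frameTransportMat_map, quadResEnd_map_apply_mk, placeVec_conjFrameTransport, placeVec_conjFrameTransport]

end Levi

end HodgeCM.Model.ArchSideTerm

end
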